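import Summits.BirchSwinnertonDyer.BirchSwinnertonDyer.Theses.ManinLocalTwoThree
import Summits.BirchSwinnertonDyer.BirchSwinnertonDyer.Theorems.ManinLocalTwoThreeManinPrimeToAdditiveFiveLeOptimalPartner
import Summits.BirchSwinnertonDyer.BirchSwinnertonDyer.Theorems.ManinLocalTwoThreeManinPrimeToAdditiveFiveLeKatoReductionFiveLe
import Summits.BirchSwinnertonDyer.BirchSwinnertonDyer.Theorems.ManinLocalTwoThreeManinPrimeToAdditiveFiveLeReducibleResidueSharp
import Summits.BirchSwinnertonDyer.BirchSwinnertonDyer.Theorems.ManinLocalTwoThreeManinPrimeToAdditiveFiveLeReducibleResidueThirteenStub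
import Summits.BirchSwinnertonDyer.BirchSwinnertonDyer.Theorems.ManinLocalTwoThreeManinPrimeToAdditiveFiveLeReducibleThirteenDegreeUp
import Summits.BirchSwinnertonDyer.BirchSwinnertonDyer.Theorems.ManinLocalTwoThreeManinPrimeToAdditiveFiveLeRedFiveSevenSharpSplit
import Summits.BirchSwinnertonDyer.BirchSwinnertonDyer.Theorems.ManinLocalTwoThreeManinPrimeToAdditiveFiveLeRedFiveTypeIIFlipTwin
import Summits.BirchSwinnertonDyer.BirchSwinnertonDyer.Theorems.ManinLocalTwoThreeManinPrimeToAdditiveFiveLeBistarredGord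
import Summits.BirchSwinnertonDyer.BirchSwinnertonDyer.Theorems.ManinLocalTwoThreeManinPrimeToAdditiveFiveLeTypeIIAtFiveCornerOfUnstarredLaw
import HarnessLib

/-!
# Crux `ManinPrimeToAdditiveFiveLe` (stmt-BirchSwinnertonDyer-22969) — line «raynaud-cells», skeleton rev 2
# (bsd-idea-8 gen 4, lens «nearmiss», 2026-08-28; PUBLISH-ONLY per W-79: the line of record is the LEAD's `Lines/upper_anchor.lean`)

BSD is not proved by any of this; crux C5 is NOT proved; every `stub_*` below is OPEN (sorried) unless marked closed.

## rev 2 = critic V#36 prices P1 + H1 + H2, re-socketed on the LEAD's v8 (sha16 f41b6313bdbd3fbd)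
* SOCKET: this file is the LEAD's v8 `upper_anchor.lean` VERBATIM (imports, opens, the stubs `stub_printedInputs`,
  `stub_kp57`, `stub_optimalUnstarredNonGord57`, `stub_degreeUp13Red` (the closed record stub `stub_optimalPartner` omitted), the theorems
  `typeIIAtFiveCorner_of_unstarredLaw`, `red57unstarred_of_flipTwin`, `red57bistarred_of_dokchitser_of_unstarredLaw`,
  `red57sharp_of_split`, `red13sharp_of_degreeUp13Red`, `ManinPrimeToAdditiveFiveLe_of`) with ONE stub —
  `stub_red57unstarredOffIIAtFive` (the `W[p]`-reducible UNSTARRED residue at `p ∈ {5,7}` off the Kodaira-II cell at 5; «no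
  anchor in tree or print») — replaced by THREE cell stubs and a sorry-free exhaustive glue (`red57unstarredOffIIAtFive_of_hyps`
  / `_of_cells`). Stubs of rev 2: 7 = stubs_max (P, K, SS57, ORD7, CORNER57, U, DEG13).
* P1 (re-cut): `stub_ss57` = EXACTLY the portable cell {(5;IV), (7;III)} (potentially supersingular, `e_p(W) < p − 1`);
  `stub_ord7` = the cell (7;IV) on its own (potentially ordinary, research engine NMI″ + POS, NOT a port, no prover);
  `stub_corner57` = the Kummer corners {(5;III), (7;II)} (`e = p − 1`, NO engine). BC7 on this cut: SS57 / ORD7 / CORNER57 CLEAN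
  (evidence `bc7-22969-raynaud_cells.out`); the coarser rev-1 cut RAYNAUD57 / CORNER57B CLEAN (`bc7-22969-raynaud_cells_v7.out`).
* H1: `ManinPrimeToAdditiveFiveLe_of_hyps` — the composition with the seven stub STATEMENTS as hypotheses (`type_of% stub_…`),
  stub-free proof term (`#print axioms` prints no `sorryAx`): certifies the glue. `ManinPrimeToAdditiveFiveLe_of` (applied to the
  stubs) is kept as the by-name conclusion.
* H2: every copied stub's docstring now says «VERBATIM from the LEAD's upper_anchor.lean v8, sha16 f41b6313bdbd3fbd».
* P2: typescript quotes (a)(b)(c) with texel.txt line numbers are in `Lines/raynaud-cells-quotes.md`; texel.txt is mirrored at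
  `run/shared/lean/pub/ideators/bsd-idea-8/lines/edixhoven/`. New from that reading: Prop. 7 has a SECOND p-sensitive step
  (component multiplicities of X̃_{T,t} < p, L447–450, unquantified in print) — added to SS57's «why it might fail»; and for
  UNSTARRED potentially supersingular `W` Edixhoven's chain is `α`-free (irreducibility enters only the transfer to the starred
  partner, L653–699), which is why the LEAD's law (U) «optimal ⟹ unstarred» is the right companion of SS57.

## The cells (Kodaira type at p ↔ `v = ord_p Δ_min` ↔ `e_p(W) = 12/gcd(12,v)`; Raynaud needs `e < p − 1`)
| cell | p | v | e | p − 1 | reduction | stub | engine |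
|---|---|---|---|---|---|---|---|
| (5;IV) | 5 | 4 | 3 | 4 | pot. supersingular | `stub_ss57` | PORT of Edixhoven Props 4–8 + trichotomy + parity at e < p − 1 |
| (7;III) | 7 | 3 | 4 | 6 | pot. supersingular | `stub_ss57` | same |
| (7;IV) | 7 | 4 | 3 | 6 | pot. ordinary | `stub_ord7` | nebentypus descent to Γ_H(7M) over the cubic field + POS (research) |
| (5;III) | 5 | 3 | 4 | 4 | pot. ordinary | `stub_corner57` | none (Kummer corner, e = p − 1) |
| (7;II) | 7 | 2 | 6 | 6 | pot. ordinary | `stub_corner57` | none (Kummer corner, e = p − 1) |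
| (5;II) | 5 | 2 | 6 | 4 | pot. ordinary | — (LEAD: flip twin p622240 → (5;IV)) | LEAD |

## rev 1 card (kept): NEAR-MISS on Edixhoven 1991 Thm. 3
Thm. 3's hypothesis `p > 7` is a proxy for the REAL hypothesis of its Prop. 7, `e(T/S) < p − 1` (Raynaud's specialisation
lemma over the minimal good-reduction extension), which is a PER-CURVE condition `e_p(W) < p − 1` and holds on the cells above
the corner rows; irreducibility of `W[p]` enters the printed proof only through the isogeny `α` of the twist chain (§4), which
the unstarred potentially supersingular branch does not use. Hence the printed METHOD reaches the `W[p]`-REDUCIBLE unstarred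
cells (5;IV), (7;III) that the printed THEOREM excludes — the first prover-shaped object on the reducible residue of C5.
Kill: a failure of Prop. 7's multiplicity step or of Prop. 8's estimates at p ∈ {5,7} kills the PORT (not the statements); one
optimal curve in a cell with `p ∣ c` kills the statement; the Manin-free degree/flip pattern of the LEAD's census run beyond
`5·10⁵` is the instrument row. Sources: [EdixhovenManin1991] typescript texel.txt; [Edixhoven1990StableReduction];
[Raynaud1974]; [Mazur1978]; [ConradEdixhovenStein2003]; [AtkinLi1978]; [Stevens1989Invent]; [CesnaviciusNeururerSaha2023].
-/

/-! ## History (v1–v3, ideator bsd-idea-8 + lead gen 0/1) — pointer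

The original line card («upper anchor»: Edixhoven 1991 Thm. 3 as near-miss; the an-cell's PROVED near-invariance
`pStar_optimal_commuting_manin_near_invariance` closing C5 from an UPPER ANCHOR on the starred member of a commuting
optimal `χ_{p*}`-pair plus a DIRECTION LAW; stubs `stub_optimalPartner` [PROVED p606476], `stub_upperAnchor`,
`stub_directionLawIrr`, `stub_reducibleTwistMinimal`, all closed MODULO named facts by gens 1–2) is kept verbatim in
the tree history of this file (commit eb90aa6b1e0b, skeleton v6) and in `Cruxes/…/LEDGER-upper-anchor.md`.
-/

set_option autoImplicit false
set_option linter.dupNamespace false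

noncomputable section

open scoped NumberField

open WeierstrassCurve IsDedekindDomain NumberField Literature.NumberTheory.EllipticCurves
  Literature.NumberTheory.EllipticCurves.ModularForms
  Summit.BirchSwinnertonDyer.Rank1Residual.ManinAdditive
  Summit.BirchSwinnertonDyer.BirchSwinnertonDyer.Theses.EdixhovenFibreFiveSeven
  Summit.BirchSwinnertonDyer.BirchSwinnertonDyer.Theorems

namespace Summit.BirchSwinnertonDyer.BirchSwinnertonDyer.Cruxes.ManinPrimeToAdditiveFiveLe.RaynaudCells

/-- STUB P — **the printed inputs** (SEVEN cite-only Literature facts as ONE conjunction — v8 adds Dokchitser–Dokchitser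
2015 Thm. 5.1 (1) `dokchitser_padicValInt_minimalDiscriminantInt_eq_of_isogeny_of_potentiallyGoodOrdinary` as conjunct 7
[cite: DokchitserDokchitser2015LocalInvariants, Thm. 5.1 (1)]; NOT a prover target —
each conjunct is a statement-only `def … : Prop` that closes only by an XL `_holds` port under `Literature/`):
Kato F″ `kato_neron_isIntegral_twistedSymbolSum_of_additive_five_le` (Kato (8.1.3)/9.7/6.6 + Kim–Nakamura 2.4 +
Kosters–Pannekoek Thm 1, derived reading), ČNS Thm 1.2, Cremona's table `N ≤ 5·10⁵`, Edixhoven 1991 Thm 3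
(Kodaira half, ordinarity half), Mazur 1978 Thm 1 with the rational points of `X₀(p)`.
[cite: Kato2004Asterisque, (8.1.3) (p. 180), Thm. 9.7 (p. 189)] [cite: CesnaviciusNeururerSaha2023, Thm. 1.2]
[cite: EdixhovenManin1991, Thm. 3] [cite: Mazur1978, Thm. 1] 
(raynaud-cells rev 2: docstring and statement copied VERBATIM from the LEAD's `Lines/upper_anchor.lean` v8, sha16 f41b6313bdbd3fbd.) -/
theorem stub_printedInputs :
    kato_neron_isIntegral_twistedSymbolSum_of_additive_five_le ∧
    cesnaviciusNeururerSaha_padicVal_maninConstant_le_modularDegree ∧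
    cremona_abs_maninConstant_eq_one_of_level_le_500000 ∧
    edixhoven_not_dvd_maninConstant_of_kodairaSymbol_ne ∧
    edixhoven_not_dvd_maninConstant_of_not_potentiallyGoodOrdinary ∧
    mazur_j_mem_of_not_hasIrreducibleModPGaloisRep_of_eleven_le ∧
    dokchitser_padicValInt_minimalDiscriminantInt_eq_of_isogeny_of_potentiallyGoodOrdinary := by
  sorry

/-- STUB K — **crux KP57 BY NAME** (`EdixhovenFibreFiveSeven.KPResidueManinUnitFiveSeven`,
stmt-BirchSwinnertonDyer-23810, route `EdixhovenFibreFiveSeven`, cell `pub/bsd-wall`): `p ∈ {5,7}`, `W[p]`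
irreducible, additive with a `ℚ_p`-rational point of order `p` (Kosters–Pannekoek exceptional fibre), `p ∣` every
conductor-level degree, `N > 5·10⁵` ⟹ some conductor-level datum has `p ∤ c`. OPEN; owned there.
[cite: KostersPannekoek2017, Cor. 2] [cite: EdixhovenManin1991, Thm. 3] 
(raynaud-cells rev 2: docstring and statement copied VERBATIM from the LEAD's `Lines/upper_anchor.lean` v8, sha16 f41b6313bdbd3fbd.) -/
theorem stub_kp57 : KPResidueManinUnitFiveSeven := by
  sorry

/-- STUB SS57 (NEW, rev 2 = critic V#36 price P1: EXACTLY the portable cell; rank 2, the engine stub of this line) —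
**the potentially SUPERSINGULAR Raynaud-admissible `W[p]`-reducible unstarred cells `(5;IV)` (`e = 3 < 4`) and `(7;III)`
(`e = 4 < 6`)**: the LEAD's v8 `stub_red57unstarredOffIIAtFive` (= hypothesis `hA` of the landed
`coreRED57unstarred_of_cns_of_offTypeIIAtFive_of_typeIIAtFiveCorner`, p622240, whose statement is copied VERBATIM from
`Lines/upper_anchor.lean` v8, sha16 f41b6313bdbd3fbd) with its two valuation binders replaced by the cell clause
`(p = 5 ∧ ord₅ Δ_min = 4) ∨ (p = 7 ∧ ord₇ Δ_min = 3)`. ENGINE = a PORT of Edixhoven's printed METHOD at parameters his printed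
THEOREM excludes (memo `Lines/raynaud-cells-quotes.md`, texel.txt locators): Prop. 4 (table), Props. 5–6 (μ_n-action, [Edixhoven
1990]), Prop. 7 with Raynaud applied over the minimal good-reduction extension `T/S` of index `e_p(W) < p − 1` (L404–414 «this
explains the hypothesis p > 7»), Prop. 8 (separable on a component ⇒ `p ∤ c`), the period-lattice trichotomy for the `χ_{p*}`-twist
(L640–652) and the parity lemma for potentially supersingular `E` (L705–710: only case 2, i.e. `φ` ITSELF separable) — for UNSTARRED
`W` this chain is `α`-free, hence irreducibility-free (the isogeny `α` and Mazur–Kenku enter only at L653–699, to transfer to the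
starred partner). WHY IT MIGHT FAIL: (i) Prop. 7's second p-sensitive step «multiplicities of the components of X̃_{T,t} are < p»
(L447–450) is unquantified in print — at `(p,e) = (5,3), (7,4)` the quotient index is `n/e = 4, 6`, fine only if no component has a
larger multiplicity; (ii) Prop. 8's vanishing-order estimates («sharp enough») and the parity lemma are only sketched (details in
Edixhoven's thesis §4.6, acq-13486). Either failure at p ∈ {5,7} kills the port, not the statement. CHEAPEST FALSIFIER (Manin-free):
an optimal `χ_{p*}`-orbit in the cell beyond `5·10⁵` that does NOT flip (lead's TWISTCENSUS2 pattern), or one optimal curve in the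
cell with `p ∣ c`. BC7 (this cut, v6/v7-socketed statements = these): SS57 CLEAN. Size XL (port of [Edixhoven 1990] + Props 5–8).
[cite: EdixhovenManin1991, Props. 4–9 and §4] [cite: Edixhoven1990StableReduction] [cite: Raynaud1974, Cor. 3.3.6.1]
[cite: CesnaviciusNeururerSaha2023, Thm. 1.2] -/
theorem stub_ss57 :
    mazur_not_dvd_maninConstant_of_odd → abbesUllmo_not_dvd_maninConstant_of_not_dvd_level →
    cesnavicius_not_two_dvd_maninConstant_of_two_dvd_level → exists_isNewformOf →
    ∀ (W : WeierstrassCurve ℚ) [W.IsElliptic] [W.IsGloballyMinimal] [NeZero (W.conductorNorm ℤ)]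
      (D : ModularParametrizationData W (W.conductorNorm ℤ)),
      IsLatticeOptimal D → ∀ (p : ℕ) (hp : p.Prime), (p = 5 ∨ p = 7) → p ^ 2 ∣ W.conductorNorm ℤ →
      ¬ (∃ (W' : WeierstrassCurve ℚ) (q : ℕ), W'.IsElliptic ∧ W'.IsGloballyMinimal ∧ q.Prime ∧
          q ≠ 2 ∧ q ^ 2 ∣ W.conductorNorm ℤ ∧
          IsIsogenous W (W'.quadraticTwist (((-1 : ℤ) ^ (q / 2) * q : ℤ) : ℚ)) ∧
          ¬ q ^ 2 ∣ W'.conductorNorm ℤ) →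
      ¬ (∃ (W' : WeierstrassCurve ℚ) (d : ℤ), W'.IsElliptic ∧ W'.IsGloballyMinimal ∧
          (d = -1 ∨ d = 2 ∨ d = -2) ∧ 2 ^ 2 ∣ W.conductorNorm ℤ ∧
          IsIsogenous W (W'.quadraticTwist (d : ℚ)) ∧ ¬ 2 ^ 2 ∣ W'.conductorNorm ℤ) →
      ¬ W.HasIrreducibleModPGaloisRep p →
      500000 < W.conductorNorm ℤ →
      p ∣ D.modularDegree →
      (∀ n : ℕ, W.kodairaSymbolAt ((Rat.HeightOneSpectrum.primesEquiv (R := ℤ)).symm ⟨p, hp⟩) ≠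
        .Istar n) →
      ((p = 5 ∧ padicValInt p W.minimalDiscriminantInt = 4) ∨
        (p = 7 ∧ padicValInt p W.minimalDiscriminantInt = 3)) →
      ¬ (p : ℤ) ∣ D.maninConstant := by
  sorry

/-- STUB ORD7 (NEW, rev 2: its OWN stub per critic V#36 P1 — RESEARCH-grade engine, not a port; no prover to be seated on it) —
**the potentially ORDINARY Raynaud-admissible cell `(7;IV)` (`e = 3 < 6`, `7 ≡ 1 mod 3`)** of the LEAD's v8
`stub_red57unstarredOffIIAtFive` (statement VERBATIM from `Lines/upper_anchor.lean` v8 sha16 f41b6313bdbd3fbd, valuation binders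
replaced by `p = 7 ∧ ord₇ Δ_min = 4`). Edixhoven's method stops here at `v₇(c) ≤ 1` (Prop. 9; his printed exception at 7).
ENGINE (crux idea `Ideas/nebentypus-position.md` rev 3): `W[7]` reducible ⇒ principal series at 7 with `ε` of order 3,
`f_W = g ⊗ ε̃` with `g` new on `Γ_H(7M)`, `H = ker ε²`; `J_H(7M)` acquires semistable reduction over the cubic field
`K₃ ⊂ ℚ(ζ₇)` (`e″ = 3 < 6`, Raynaud-admissible) where `A_g` has GOOD reduction, so a Mazur-1978-type argument should give the
Manin INDEX of `A_g` prime to `𝔭` without irreducibility (NMI″ — in print only as Conrad–Edixhoven–Stein 2003 Conj. 6.1.7-type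
statements, OPEN), and the Teichmüller comparison `Res W ∼ A_g` transfers it to `W` up to the isogeny POSITION lemma POS
(orientation-free: the comparison isogeny between the `J_H(7M)`-optimal `A_g` and the trace-zero piece `B_W` of the X₀-optimal
`W` has degree prime to `𝔭`; Stevens 1989 / Vatsal 2005 direction). TWO research inputs (NMI″, POS) ⇒ this is an IDEATION /
literature object, recorded as a stub only so that the cell is NAMED and the glue is exhaustive. WHY IT MIGHT FAIL: POS may be
false for some optimal `W` of type IV at 7 with a rational 7-isogeny (the mechanism then predicts `7 ∣ c`); NMI″ may fail the way
Joyce's examples fail the orbit version of CES Conj. 6.1.7. CHEAPEST FALSIFIER (Manin-free): a commuting optimal `χ_{−7}`-orbit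
(IV ↔ II*) beyond `5·10⁵` with `7·deg(D′) ≠ deg(D)·(unit)` pattern of the lead's header, or POS decided negatively in range from
Cremona's optimal marks + Néron lattices (instrument row, kit). BC7: ORD7 CLEAN.
[cite: EdixhovenManin1991, Thm. 3, Prop. 9] [cite: Mazur1978, Cor. 4.1] [cite: ConradEdixhovenStein2003, §6.1]
[cite: AtkinLi1978, Thm. 3.1] [cite: Stevens1989Invent, §2] [cite: Vatsal2005MultiplicativeSubgroups] -/
theorem stub_ord7 :
    mazur_not_dvd_maninConstant_of_odd → abbesUllmo_not_dvd_maninConstant_of_not_dvd_level →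
    cesnavicius_not_two_dvd_maninConstant_of_two_dvd_level → exists_isNewformOf →
    ∀ (W : WeierstrassCurve ℚ) [W.IsElliptic] [W.IsGloballyMinimal] [NeZero (W.conductorNorm ℤ)]
      (D : ModularParametrizationData W (W.conductorNorm ℤ)),
      IsLatticeOptimal D → ∀ (p : ℕ) (hp : p.Prime), (p = 5 ∨ p = 7) → p ^ 2 ∣ W.conductorNorm ℤ →
      ¬ (∃ (W' : WeierstrassCurve ℚ) (q : ℕ), W'.IsElliptic ∧ W'.IsGloballyMinimal ∧ q.Prime ∧
          q ≠ 2 ∧ q ^ 2 ∣ W.conductorNorm ℤ ∧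
          IsIsogenous W (W'.quadraticTwist (((-1 : ℤ) ^ (q / 2) * q : ℤ) : ℚ)) ∧
          ¬ q ^ 2 ∣ W'.conductorNorm ℤ) →
      ¬ (∃ (W' : WeierstrassCurve ℚ) (d : ℤ), W'.IsElliptic ∧ W'.IsGloballyMinimal ∧
          (d = -1 ∨ d = 2 ∨ d = -2) ∧ 2 ^ 2 ∣ W.conductorNorm ℤ ∧
          IsIsogenous W (W'.quadraticTwist (d : ℚ)) ∧ ¬ 2 ^ 2 ∣ W'.conductorNorm ℤ) →
      ¬ W.HasIrreducibleModPGaloisRep p →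
      500000 < W.conductorNorm ℤ →
      p ∣ D.modularDegree →
      (∀ n : ℕ, W.kodairaSymbolAt ((Rat.HeightOneSpectrum.primesEquiv (R := ℤ)).symm ⟨p, hp⟩) ≠
        .Istar n) →
      (p = 7 ∧ padicValInt p W.minimalDiscriminantInt = 4) →
      ¬ (p : ℤ) ∣ D.maninConstant := by
  sorry

/-- STUB CORNER57 (NEW, residual of this line — NO engine claimed) — **the Kummer corners `e_p(W) = p − 1` of the
`W[p]`-reducible unstarred residue at p ≤ 7**: the LEAD's v8 `stub_red57unstarredOffIIAtFive` (statement VERBATIM from `Lines/upper_anchor.lean` v8 sha16 f41b6313bdbd3fbd) restricted to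
`(p = 5 ∧ ord₅ Δ_min ≤ 3 ∧ ord₅ Δ_min ≠ 2)` (Kodaira III at 5, `e = 4 = p − 1`, potentially ordinary, commuting orbits) or
`(p = 7 ∧ ord₇ Δ_min ≤ 2)` (Kodaira II at 7, `e = 6 = p − 1`, potentially ordinary, commuting orbits II ↔ IV*). Here Raynaud's
specialisation lemma is void on BOTH sides (Edixhoven's `T`, and the nebentypus field `K_e = ℚ_p(ζ_p)`, have `e = p − 1`), the
Kato road needs `W[p]` irreducible, and no statement in print or tree reaches these rows; it is the `W[p]`-REDUCIBLE twin of
route TeichmullerTwistDescent's Kummer corner (typed there under irreducibility + rational p-torsion), and the only lead is a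
Conrad–Edixhoven–Stein-type analysis at `e = p − 1` (they treat `X_H(p)` over `ℤ_p`, multiplicities `1` and `[(ℤ/p)^×/±1 : H]`,
§5). Junk values `ord_p Δ_min ≤ 1` ride along (vacuous under `p² ∣ N`). The Kodaira-II cell at 5 (`e = 6 > p − 1`) is NOT here:
the lead's flip-twin theorem p622240 moves it onto the cell (5;IV) of `stub_ss57`. BC7: CORNER57 CLEAN. WHY IT MIGHT FAIL: it is Manin's conjecture
on the reducible Kummer corners; one optimal curve of type III at 5 (or II at 7) with a rational p-isogeny, `N > 5·10⁵` and
`p ∣ c` refutes it. [cite: EdixhovenManin1991, Prop. 7] [cite: ConradEdixhovenStein2003, §5, §6.1]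
[cite: CesnaviciusNeururerSaha2023, Thm. 1.2] -/
theorem stub_corner57 :
    mazur_not_dvd_maninConstant_of_odd → abbesUllmo_not_dvd_maninConstant_of_not_dvd_level →
    cesnavicius_not_two_dvd_maninConstant_of_two_dvd_level → exists_isNewformOf →
    ∀ (W : WeierstrassCurve ℚ) [W.IsElliptic] [W.IsGloballyMinimal] [NeZero (W.conductorNorm ℤ)]
      (D : ModularParametrizationData W (W.conductorNorm ℤ)),
      IsLatticeOptimal D → ∀ (p : ℕ) (hp : p.Prime), (p = 5 ∨ p = 7) → p ^ 2 ∣ W.conductorNorm ℤ →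
      ¬ (∃ (W' : WeierstrassCurve ℚ) (q : ℕ), W'.IsElliptic ∧ W'.IsGloballyMinimal ∧ q.Prime ∧
          q ≠ 2 ∧ q ^ 2 ∣ W.conductorNorm ℤ ∧
          IsIsogenous W (W'.quadraticTwist (((-1 : ℤ) ^ (q / 2) * q : ℤ) : ℚ)) ∧
          ¬ q ^ 2 ∣ W'.conductorNorm ℤ) →
      ¬ (∃ (W' : WeierstrassCurve ℚ) (d : ℤ), W'.IsElliptic ∧ W'.IsGloballyMinimal ∧
          (d = -1 ∨ d = 2 ∨ d = -2) ∧ 2 ^ 2 ∣ W.conductorNorm ℤ ∧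
          IsIsogenous W (W'.quadraticTwist (d : ℚ)) ∧ ¬ 2 ^ 2 ∣ W'.conductorNorm ℤ) →
      ¬ W.HasIrreducibleModPGaloisRep p →
      500000 < W.conductorNorm ℤ →
      p ∣ D.modularDegree →
      (∀ n : ℕ, W.kodairaSymbolAt ((Rat.HeightOneSpectrum.primesEquiv (R := ℤ)).symm ⟨p, hp⟩) ≠
        .Istar n) →
      ((p = 5 ∧ padicValInt p W.minimalDiscriminantInt ≤ 3 ∧ padicValInt p W.minimalDiscriminantInt ≠ 2) ∨
        (p = 7 ∧ padicValInt p W.minimalDiscriminantInt ≤ 2)) →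
      ¬ (p : ℤ) ∣ D.maninConstant := by
  sorry

/-- GLUE, hypothesis-taking form (sorry-free, no stub inside): the three cells SS57 ∪ ORD7 ∪ CORNER57 exhaust the LEAD's v8
`stub_red57unstarredOffIIAtFive` (statement VERBATIM): case split on `p ∈ {5, 7}`, `ord_p Δ_min(W) ≤ 4` and
`p = 5 → ord_p Δ_min(W) ≠ 2` (rows `ord_p Δ_min ≤ 1` ride in CORNER57, vacuous under `p² ∣ N`). -/
theorem red57unstarredOffIIAtFive_of_hyps (hSS : type_of% stub_ss57) (hORD : type_of% stub_ord7)
    (hC : type_of% stub_corner57) :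
    mazur_not_dvd_maninConstant_of_odd → abbesUllmo_not_dvd_maninConstant_of_not_dvd_level →
    cesnavicius_not_two_dvd_maninConstant_of_two_dvd_level → exists_isNewformOf →
    ∀ (W : WeierstrassCurve ℚ) [W.IsElliptic] [W.IsGloballyMinimal] [NeZero (W.conductorNorm ℤ)]
      (D : ModularParametrizationData W (W.conductorNorm ℤ)),
      IsLatticeOptimal D → ∀ (p : ℕ) (hp : p.Prime), (p = 5 ∨ p = 7) → p ^ 2 ∣ W.conductorNorm ℤ →
      ¬ (∃ (W' : WeierstrassCurve ℚ) (q : ℕ), W'.IsElliptic ∧ W'.IsGloballyMinimal ∧ q.Prime ∧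
          q ≠ 2 ∧ q ^ 2 ∣ W.conductorNorm ℤ ∧
          IsIsogenous W (W'.quadraticTwist (((-1 : ℤ) ^ (q / 2) * q : ℤ) : ℚ)) ∧
          ¬ q ^ 2 ∣ W'.conductorNorm ℤ) →
      ¬ (∃ (W' : WeierstrassCurve ℚ) (d : ℤ), W'.IsElliptic ∧ W'.IsGloballyMinimal ∧
          (d = -1 ∨ d = 2 ∨ d = -2) ∧ 2 ^ 2 ∣ W.conductorNorm ℤ ∧
          IsIsogenous W (W'.quadraticTwist (d : ℚ)) ∧ ¬ 2 ^ 2 ∣ W'.conductorNorm ℤ) →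
      ¬ W.HasIrreducibleModPGaloisRep p →
      500000 < W.conductorNorm ℤ →
      p ∣ D.modularDegree →
      (∀ n : ℕ, W.kodairaSymbolAt ((Rat.HeightOneSpectrum.primesEquiv (R := ℤ)).symm ⟨p, hp⟩) ≠
        .Istar n) →
      padicValInt p W.minimalDiscriminantInt ≤ 4 →
      (p = 5 → padicValInt p W.minimalDiscriminantInt ≠ 2) →
      ¬ (p : ℤ) ∣ D.maninConstant := by
  intro hM hAU hC2 hNew W i1 i2 i3 D hopt p hp h57 hp2 htm h2 hred hN hdeg hI hv hII
  rcases h57 with h5 | h7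
  · subst h5
    by_cases h4 : padicValInt 5 W.minimalDiscriminantInt = 4
    · exact hSS hM hAU hC2 hNew W D hopt 5 hp (Or.inl rfl) hp2 htm h2 hred hN hdeg hI
        (Or.inl ⟨rfl, h4⟩)
    · exact hC hM hAU hC2 hNew W D hopt 5 hp (Or.inl rfl) hp2 htm h2 hred hN hdeg hI
        (Or.inl ⟨rfl, by omega, hII rfl⟩)
  · subst h7
    by_cases h4 : padicValInt 7 W.minimalDiscriminantInt = 4
    · exact hORD hM hAU hC2 hNew W D hopt 7 hp (Or.inr rfl) hp2 htm h2 hred hN hdeg hI ⟨rfl, h4⟩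
    · by_cases h3 : padicValInt 7 W.minimalDiscriminantInt = 3
      · exact hSS hM hAU hC2 hNew W D hopt 7 hp (Or.inr rfl) hp2 htm h2 hred hN hdeg hI
          (Or.inr ⟨rfl, h3⟩)
      · exact hC hM hAU hC2 hNew W D hopt 7 hp (Or.inr rfl) hp2 htm h2 hred hN hdeg hI
          (Or.inr ⟨rfl, by omega⟩)

/-- GLUE (sorry-free outside the three cell stubs): the LEAD's v8 `stub_red57unstarredOffIIAtFive`, VERBATIM statement
(= hypothesis `hA` of `coreRED57unstarred_of_cns_of_offTypeIIAtFive_of_typeIIAtFiveCorner`, p622240), from the cells. -/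
theorem red57unstarredOffIIAtFive_of_cells :
    mazur_not_dvd_maninConstant_of_odd → abbesUllmo_not_dvd_maninConstant_of_not_dvd_level →
    cesnavicius_not_two_dvd_maninConstant_of_two_dvd_level → exists_isNewformOf →
    ∀ (W : WeierstrassCurve ℚ) [W.IsElliptic] [W.IsGloballyMinimal] [NeZero (W.conductorNorm ℤ)]
      (D : ModularParametrizationData W (W.conductorNorm ℤ)),
      IsLatticeOptimal D → ∀ (p : ℕ) (hp : p.Prime), (p = 5 ∨ p = 7) → p ^ 2 ∣ W.conductorNorm ℤ →
      ¬ (∃ (W' : WeierstrassCurve ℚ) (q : ℕ), W'.IsElliptic ∧ W'.IsGloballyMinimal ∧ q.Prime ∧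
          q ≠ 2 ∧ q ^ 2 ∣ W.conductorNorm ℤ ∧
          IsIsogenous W (W'.quadraticTwist (((-1 : ℤ) ^ (q / 2) * q : ℤ) : ℚ)) ∧
          ¬ q ^ 2 ∣ W'.conductorNorm ℤ) →
      ¬ (∃ (W' : WeierstrassCurve ℚ) (d : ℤ), W'.IsElliptic ∧ W'.IsGloballyMinimal ∧
          (d = -1 ∨ d = 2 ∨ d = -2) ∧ 2 ^ 2 ∣ W.conductorNorm ℤ ∧
          IsIsogenous W (W'.quadraticTwist (d : ℚ)) ∧ ¬ 2 ^ 2 ∣ W'.conductorNorm ℤ) →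
      ¬ W.HasIrreducibleModPGaloisRep p →
      500000 < W.conductorNorm ℤ →
      p ∣ D.modularDegree →
      (∀ n : ℕ, W.kodairaSymbolAt ((Rat.HeightOneSpectrum.primesEquiv (R := ℤ)).symm ⟨p, hp⟩) ≠
        .Istar n) →
      padicValInt p W.minimalDiscriminantInt ≤ 4 →
      (p = 5 → padicValInt p W.minimalDiscriminantInt ≠ 2) →
      ¬ (p : ℤ) ∣ D.maninConstant :=
  red57unstarredOffIIAtFive_of_hyps stub_ss57 stub_ord7 stub_corner57

/-- STUB U — **law (U): «optimal ⟹ unstarred» on the potentially supersingular `W[p]`-reducible locus at `p ∈ {5, 7}`**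
(Manin-free, degree-free; hypothesis `hU` of the lead's `cornerTypeIIAtFive_of_optimalUnstarredNonGord` (μ), VERBATIM;
= the width seat's `hU` of p621355 §2 without its `p ∣ deg φ` binder): for `W` globally minimal with a LATTICE-OPTIMAL
conductor-level datum, `p ∈ {5,7}`, `p² ∣ N(W) > 5·10⁵`, globally twist-minimal, `W[p]` reducible, no `Iₙ*` fibre at
`p`, NOT (G)-ordinary at `p`: `ord_p Δ_min(W) ≤ 4`. Census N ≤ 5·10⁵: 0 exceptions (the optimal curve of every
potentially supersingular reducible class is its unstarred member: 771 + 771 flip rows at 5, 122 at 7). Conjecture-shaped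
(Stevens-type minimality: the unstarred `p`-isogenous partner has the smaller Faltings height, Gealy–Klagsbrun 2017);
OPEN, beyond print (Stein–Watkins-type statements are proved only for semistable N: Byeon–Kim 2014 / Vatsal 2005).
[cite: Stevens1989, §2] [cite: GealyKlagsbrun2017, Thm. 1] 
(raynaud-cells rev 2: docstring and statement copied VERBATIM from the LEAD's `Lines/upper_anchor.lean` v8, sha16 f41b6313bdbd3fbd.) -/
theorem stub_optimalUnstarredNonGord57 :
    exists_isNewformOf →
    ∀ (W : WeierstrassCurve ℚ) [W.IsElliptic] [W.IsGloballyMinimal] [NeZero (W.conductorNorm ℤ)]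
      (D : ModularParametrizationData W (W.conductorNorm ℤ)),
      IsLatticeOptimal D → ∀ (p : ℕ) (hp : p.Prime), (p = 5 ∨ p = 7) → p ^ 2 ∣ W.conductorNorm ℤ →
      ¬ (∃ (W' : WeierstrassCurve ℚ) (q : ℕ), W'.IsElliptic ∧ W'.IsGloballyMinimal ∧ q.Prime ∧
          q ≠ 2 ∧ q ^ 2 ∣ W.conductorNorm ℤ ∧
          IsIsogenous W (W'.quadraticTwist (((-1 : ℤ) ^ (q / 2) * q : ℤ) : ℚ)) ∧
          ¬ q ^ 2 ∣ W'.conductorNorm ℤ) →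
      ¬ (∃ (W' : WeierstrassCurve ℚ) (d : ℤ), W'.IsElliptic ∧ W'.IsGloballyMinimal ∧
          (d = -1 ∨ d = 2 ∨ d = -2) ∧ 2 ^ 2 ∣ W.conductorNorm ℤ ∧
          IsIsogenous W (W'.quadraticTwist (d : ℚ)) ∧ ¬ 2 ^ 2 ∣ W'.conductorNorm ℤ) →
      ¬ W.HasIrreducibleModPGaloisRep p →
      500000 < W.conductorNorm ℤ →
      (∀ n : ℕ, W.kodairaSymbolAt ((Rat.HeightOneSpectrum.primesEquiv (R := ℤ)).symm ⟨p, hp⟩) ≠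
        .Istar n) →
      ¬ Summit.BirchSwinnertonDyer.Rank1Residual.Additive.TypeGOrd W p →
      padicValInt p W.minimalDiscriminantInt ≤ 4 := by
  sorry

/-- v7 STUB II5-CORNER — now a THEOREM modulo `stub_optimalUnstarredNonGord57` (law (U)), by the lead's
`cornerTypeIIAtFive_of_optimalUnstarredNonGord` (μ, gen 4): the «starred twin» corner of the Kodaira-II cell at 5 (the
starred optimal twin `W₀ ∼ W ⊗ 5` would be of type IV*, `e = 3 ∤ 4`, not (G), and (U) forbids it). Kept under its v7
statement (hypothesis `hB` of p622240, verbatim). [cite: Stevens1989, §2] [cite: SilvermanATAEC1994, IV Table 4.1] -/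
theorem typeIIAtFiveCorner_of_unstarredLaw :
    mazur_not_dvd_maninConstant_of_odd → abbesUllmo_not_dvd_maninConstant_of_not_dvd_level →
    cesnavicius_not_two_dvd_maninConstant_of_two_dvd_level → exists_isNewformOf →
    ∀ (W : WeierstrassCurve ℚ) [W.IsElliptic] [W.IsGloballyMinimal] [NeZero (W.conductorNorm ℤ)]
      (D : ModularParametrizationData W (W.conductorNorm ℤ)),
      IsLatticeOptimal D → ∀ (p : ℕ) (hp : p.Prime), (p = 5 ∨ p = 7) → p ^ 2 ∣ W.conductorNorm ℤ →
      ¬ (∃ (W' : WeierstrassCurve ℚ) (q : ℕ), W'.IsElliptic ∧ W'.IsGloballyMinimal ∧ q.Prime ∧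
          q ≠ 2 ∧ q ^ 2 ∣ W.conductorNorm ℤ ∧
          IsIsogenous W (W'.quadraticTwist (((-1 : ℤ) ^ (q / 2) * q : ℤ) : ℚ)) ∧
          ¬ q ^ 2 ∣ W'.conductorNorm ℤ) →
      ¬ (∃ (W' : WeierstrassCurve ℚ) (d : ℤ), W'.IsElliptic ∧ W'.IsGloballyMinimal ∧
          (d = -1 ∨ d = 2 ∨ d = -2) ∧ 2 ^ 2 ∣ W.conductorNorm ℤ ∧
          IsIsogenous W (W'.quadraticTwist (d : ℚ)) ∧ ¬ 2 ^ 2 ∣ W'.conductorNorm ℤ) →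
      ¬ W.HasIrreducibleModPGaloisRep p →
      500000 < W.conductorNorm ℤ →
      p ∣ D.modularDegree →
      (∀ n : ℕ, W.kodairaSymbolAt ((Rat.HeightOneSpectrum.primesEquiv (R := ℤ)).symm ⟨p, hp⟩) ≠
        .Istar n) →
      padicValInt p W.minimalDiscriminantInt ≤ 4 →
      p = 5 → padicValInt p W.minimalDiscriminantInt = 2 →
      (∀ (W₀ : WeierstrassCurve ℚ) [W₀.IsElliptic] [W₀.IsGloballyMinimal] [NeZero (W₀.conductorNorm ℤ)]
          (D₀ : ModularParametrizationData W₀ (W₀.conductorNorm ℤ)), IsLatticeOptimal D₀ →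
          IsIsogenous (W.quadraticTwist ((((-1 : ℤ) ^ (p / 2) * p : ℤ)) : ℚ)) W₀ →
          4 < padicValInt p W₀.minimalDiscriminantInt) →
      ¬ (p : ℤ) ∣ D.maninConstant :=
  cornerTypeIIAtFive_of_optimalUnstarredNonGord stub_optimalUnstarredNonGord57

/-- v6 STUB R57-LOW — now a THEOREM modulo `stub_red57unstarredOffIIAtFive`, `typeIIAtFiveCorner_of_unstarredLaw` (v8) and ČNS
(conjunct 2 of `stub_printedInputs`): RED(57♯) on the unstarred side (hypothesis `hlow` of p617914, verbatim),
by the lead's `coreRED57unstarred_of_cns_of_offTypeIIAtFive_of_typeIIAtFiveCorner` (gen 4). Kept under its v6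
statement for the composition. [cite: Stevens1989, Lemmas (5.2), (5.4)] [cite: CesnaviciusNeururerSaha2023, Thm. 1.2] -/
theorem red57unstarred_of_flipTwin :
    mazur_not_dvd_maninConstant_of_odd → abbesUllmo_not_dvd_maninConstant_of_not_dvd_level →
    cesnavicius_not_two_dvd_maninConstant_of_two_dvd_level → exists_isNewformOf →
    ∀ (W : WeierstrassCurve ℚ) [W.IsElliptic] [W.IsGloballyMinimal] [NeZero (W.conductorNorm ℤ)]
      (D : ModularParametrizationData W (W.conductorNorm ℤ)),
      IsLatticeOptimal D → ∀ (p : ℕ) (hp : p.Prime), (p = 5 ∨ p = 7) → p ^ 2 ∣ W.conductorNorm ℤ →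
      ¬ (∃ (W' : WeierstrassCurve ℚ) (q : ℕ), W'.IsElliptic ∧ W'.IsGloballyMinimal ∧ q.Prime ∧
          q ≠ 2 ∧ q ^ 2 ∣ W.conductorNorm ℤ ∧
          IsIsogenous W (W'.quadraticTwist (((-1 : ℤ) ^ (q / 2) * q : ℤ) : ℚ)) ∧
          ¬ q ^ 2 ∣ W'.conductorNorm ℤ) →
      ¬ (∃ (W' : WeierstrassCurve ℚ) (d : ℤ), W'.IsElliptic ∧ W'.IsGloballyMinimal ∧
          (d = -1 ∨ d = 2 ∨ d = -2) ∧ 2 ^ 2 ∣ W.conductorNorm ℤ ∧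
          IsIsogenous W (W'.quadraticTwist (d : ℚ)) ∧ ¬ 2 ^ 2 ∣ W'.conductorNorm ℤ) →
      ¬ W.HasIrreducibleModPGaloisRep p →
      500000 < W.conductorNorm ℤ →
      p ∣ D.modularDegree →
      (∀ n : ℕ, W.kodairaSymbolAt ((Rat.HeightOneSpectrum.primesEquiv (R := ℤ)).symm ⟨p, hp⟩) ≠
        .Istar n) →
      padicValInt p W.minimalDiscriminantInt ≤ 4 →
      ¬ (p : ℤ) ∣ D.maninConstant :=
  coreRED57unstarred_of_cns_of_offTypeIIAtFive_of_typeIIAtFiveCorner stub_printedInputs.2.1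
    red57unstarredOffIIAtFive_of_cells typeIIAtFiveCorner_of_unstarredLaw

/-- v6/v7 STUB R57-BISTAR — now a THEOREM modulo D–D 2015 (conjunct 7 of `stub_printedInputs`) and
`stub_optimalUnstarredNonGord57` (law (U)), by the width seat's `red57bistarred_of_dokchitser_of_optimalUnstarredNonGord`
(p621355 §3; its `hU` carries an idle `p ∣ deg φ` binder, supplied by weakening (U)): the «bi-starred orbit» corner at
`p ∈ {5, 7}` (starred `W` all of whose lattice-optimal `χ_{p*}`-partners are starred; (G)-ordinary half empty by
D–D Thm. 5.1 (1), potentially supersingular half empty by (U)). Kept under its v6 statement (hypothesis `hB` of p617914,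
verbatim). [cite: DokchitserDokchitser2015LocalInvariants, Thm. 5.1 (1)] [cite: Stevens1989, §2] -/
theorem red57bistarred_of_dokchitser_of_unstarredLaw :
    mazur_not_dvd_maninConstant_of_odd → abbesUllmo_not_dvd_maninConstant_of_not_dvd_level →
    cesnavicius_not_two_dvd_maninConstant_of_two_dvd_level → exists_isNewformOf →
    ∀ (W : WeierstrassCurve ℚ) [W.IsElliptic] [W.IsGloballyMinimal] [NeZero (W.conductorNorm ℤ)]
      (D : ModularParametrizationData W (W.conductorNorm ℤ)),
      IsLatticeOptimal D → ∀ (p : ℕ) (hp : p.Prime), (p = 5 ∨ p = 7) → p ^ 2 ∣ W.conductorNorm ℤ →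
      ¬ (∃ (W' : WeierstrassCurve ℚ) (q : ℕ), W'.IsElliptic ∧ W'.IsGloballyMinimal ∧ q.Prime ∧
          q ≠ 2 ∧ q ^ 2 ∣ W.conductorNorm ℤ ∧
          IsIsogenous W (W'.quadraticTwist (((-1 : ℤ) ^ (q / 2) * q : ℤ) : ℚ)) ∧
          ¬ q ^ 2 ∣ W'.conductorNorm ℤ) →
      ¬ (∃ (W' : WeierstrassCurve ℚ) (d : ℤ), W'.IsElliptic ∧ W'.IsGloballyMinimal ∧
          (d = -1 ∨ d = 2 ∨ d = -2) ∧ 2 ^ 2 ∣ W.conductorNorm ℤ ∧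
          IsIsogenous W (W'.quadraticTwist (d : ℚ)) ∧ ¬ 2 ^ 2 ∣ W'.conductorNorm ℤ) →
      ¬ W.HasIrreducibleModPGaloisRep p →
      500000 < W.conductorNorm ℤ →
      p ∣ D.modularDegree →
      (∀ n : ℕ, W.kodairaSymbolAt ((Rat.HeightOneSpectrum.primesEquiv (R := ℤ)).symm ⟨p, hp⟩) ≠
        .Istar n) →
      4 < padicValInt p W.minimalDiscriminantInt →
      (∀ (W₀ : WeierstrassCurve ℚ) [W₀.IsElliptic] [W₀.IsGloballyMinimal] [NeZero (W₀.conductorNorm ℤ)]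
          (D₀ : ModularParametrizationData W₀ (W₀.conductorNorm ℤ)), IsLatticeOptimal D₀ →
          IsIsogenous (W.quadraticTwist ((((-1 : ℤ) ^ (p / 2) * p : ℤ)) : ℚ)) W₀ →
          4 < padicValInt p W₀.minimalDiscriminantInt) →
      ¬ (p : ℤ) ∣ D.maninConstant :=
  red57bistarred_of_dokchitser_of_optimalUnstarredNonGord stub_printedInputs.2.2.2.2.2.2
    (fun hnf W _ _ _ D hD p hp h57 hpN hodd hdy hred hN _hdeg hI hG ↦
      stub_optimalUnstarredNonGord57 hnf W D hD p hp h57 hpN hodd hdy hred hN hI hG)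

/-- v4/v5 STUB R57♯ — now a THEOREM modulo `red57unstarred_of_flipTwin` (v7), `red57bistarred_of_dokchitser_of_unstarredLaw` (v8) and ČNS (conjunct 2 of
`stub_printedInputs`): the `W[p]`-reducible residue RED(57♯) at `p ∈ {5, 7}` (hypothesis `h57s` of
`coreRED57_of_cns_cremona_of_coreRED57sharp`, p612504, verbatim), by the width seat's
`coreRED57sharp_of_cns_of_unstarred_of_bistarred` (p617914). Kept under its v4 statement for the composition.
[cite: EdixhovenManin1991, Thm. 3] [cite: CesnaviciusNeururerSaha2023, Thm. 1.2] -/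
theorem red57sharp_of_split :
    mazur_not_dvd_maninConstant_of_odd → abbesUllmo_not_dvd_maninConstant_of_not_dvd_level →
    cesnavicius_not_two_dvd_maninConstant_of_two_dvd_level → exists_isNewformOf →
    ∀ (W : WeierstrassCurve ℚ) [W.IsElliptic] [W.IsGloballyMinimal] [NeZero (W.conductorNorm ℤ)]
      (D : ModularParametrizationData W (W.conductorNorm ℤ)),
      IsLatticeOptimal D → ∀ (p : ℕ) (hp : p.Prime), (p = 5 ∨ p = 7) → p ^ 2 ∣ W.conductorNorm ℤ →
      ¬ (∃ (W' : WeierstrassCurve ℚ) (q : ℕ), W'.IsElliptic ∧ W'.IsGloballyMinimal ∧ q.Prime ∧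
          q ≠ 2 ∧ q ^ 2 ∣ W.conductorNorm ℤ ∧
          IsIsogenous W (W'.quadraticTwist (((-1 : ℤ) ^ (q / 2) * q : ℤ) : ℚ)) ∧
          ¬ q ^ 2 ∣ W'.conductorNorm ℤ) →
      ¬ (∃ (W' : WeierstrassCurve ℚ) (d : ℤ), W'.IsElliptic ∧ W'.IsGloballyMinimal ∧
          (d = -1 ∨ d = 2 ∨ d = -2) ∧ 2 ^ 2 ∣ W.conductorNorm ℤ ∧
          IsIsogenous W (W'.quadraticTwist (d : ℚ)) ∧ ¬ 2 ^ 2 ∣ W'.conductorNorm ℤ) →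
      ¬ W.HasIrreducibleModPGaloisRep p →
      500000 < W.conductorNorm ℤ →
      p ∣ D.modularDegree →
      (∀ n : ℕ, W.kodairaSymbolAt ((Rat.HeightOneSpectrum.primesEquiv (R := ℤ)).symm ⟨p, hp⟩) ≠
        .Istar n) →
      ¬ (p : ℤ) ∣ D.maninConstant :=
  coreRED57sharp_of_cns_of_unstarred_of_bistarred stub_printedInputs.2.1 red57unstarred_of_flipTwin
    red57bistarred_of_dokchitser_of_unstarredLaw

/-- STUB DEG13 — **the Manin-free degree law on the `W[13]`-reducible unstarred locus** (hypothesis `hUp` of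
the lead's `coreRED13sharp_of_edixhovenKodairaFact_of_degreeUp13Red`, p618203, VERBATIM): for `W` globally minimal
with a lattice-optimal conductor-level datum `D`, `13² ∣ N(W)`, globally twist-minimal, `W[13]` reducible
(`X₀(13)` family), `ord₁₃ Δ_min(W) ≤ 4` (Kodaira II/III/IV), (G)-ordinary (idle: automatic at `13 ≡ 1 mod 12`),
`13 ∣ deg(D)`, `N(W) > 5·10⁵`, and every globally minimal `W′` with a lattice-optimal conductor-level datum `D′`,
`N(W′) = N(W)`, `W ⊗ 13 ∼ W′`: `deg(D′) = 13 · deg(D)` (the optimal degree goes UP along the twist, never down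
(Edixhoven's case 1) and never sideways (flip)). OPEN; on commuting orbits equivalent to Manin's `13 ∤ c(D)`
granted Edixhoven's Kodaira statement. [cite: EdixhovenManin1991, Thm. 3 and §4] [cite: ZagierCMB1985, §1] 
(raynaud-cells rev 2: docstring and statement copied VERBATIM from the LEAD's `Lines/upper_anchor.lean` v8, sha16 f41b6313bdbd3fbd.) -/
theorem stub_degreeUp13Red :
    exists_isNewformOf →
    ∀ (W : WeierstrassCurve ℚ) [W.IsElliptic] [W.IsGloballyMinimal] [NeZero (W.conductorNorm ℤ)]
      (D : ModularParametrizationData W (W.conductorNorm ℤ)),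
      IsLatticeOptimal D → ∀ p : ℕ, p.Prime → p = 13 → p ^ 2 ∣ W.conductorNorm ℤ →
      ¬ (∃ (W' : WeierstrassCurve ℚ) (q : ℕ), W'.IsElliptic ∧ W'.IsGloballyMinimal ∧ q.Prime ∧
          q ≠ 2 ∧ q ^ 2 ∣ W.conductorNorm ℤ ∧
          IsIsogenous W (W'.quadraticTwist (((-1 : ℤ) ^ (q / 2) * q : ℤ) : ℚ)) ∧
          ¬ q ^ 2 ∣ W'.conductorNorm ℤ) →
      ¬ (∃ (W' : WeierstrassCurve ℚ) (d : ℤ), W'.IsElliptic ∧ W'.IsGloballyMinimal ∧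
          (d = -1 ∨ d = 2 ∨ d = -2) ∧ 2 ^ 2 ∣ W.conductorNorm ℤ ∧
          IsIsogenous W (W'.quadraticTwist (d : ℚ)) ∧ ¬ 2 ^ 2 ∣ W'.conductorNorm ℤ) →
      ¬ W.HasIrreducibleModPGaloisRep p →
      padicValInt p W.minimalDiscriminantInt ≤ 4 →
      (∃ (L : Type) (_ : Field L) (_ : NumberField L) (_ : IsCyclotomicExtension {p} ℚ L)
          (F : IntermediateField ℚ L),
          ∀ w : HeightOneSpectrum (𝓞 F), (p : 𝓞 F) ∈ w.asIdeal →
            (W.baseChange F).HasGoodReductionAt w ∧ (W.baseChange F).HasUnitRootAt w) →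
      p ∣ D.modularDegree →
      500000 < W.conductorNorm ℤ →
      ∀ (W' : WeierstrassCurve ℚ) [W'.IsElliptic] [W'.IsGloballyMinimal] [NeZero (W'.conductorNorm ℤ)]
        (D' : ModularParametrizationData W' (W'.conductorNorm ℤ)),
        IsLatticeOptimal D' → W'.conductorNorm ℤ = W.conductorNorm ℤ →
        IsIsogenous (W.quadraticTwist (((-1 : ℤ) ^ (p / 2) * p : ℤ) : ℚ)) W' →
        D'.modularDegree = p * D.modularDegree := by
  sorry

/-- v4 STUB R13♯ — now a THEOREM modulo `stub_degreeUp13Red` and EdK (conjunct 4 of `stub_printedInputs`):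
the `W[13]`-reducible residue RED(13♯) (hypothesis `h13s` of `coreRED13_of_cremona_of_coreRED13sharp`, p614544,
verbatim), by the lead's `coreRED13sharp_of_edixhovenKodairaFact_of_degreeUp13Red` (p618203). Kept under its v4
statement for the record and for the composition. [cite: EdixhovenManin1991, Thm. 3 and §4] -/
theorem red13sharp_of_degreeUp13Red :
    mazur_not_dvd_maninConstant_of_odd → abbesUllmo_not_dvd_maninConstant_of_not_dvd_level →
    cesnavicius_not_two_dvd_maninConstant_of_two_dvd_level → exists_isNewformOf →
    ∀ (W : WeierstrassCurve ℚ) [W.IsElliptic] [W.IsGloballyMinimal] [NeZero (W.conductorNorm ℤ)]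
      (D : ModularParametrizationData W (W.conductorNorm ℤ)),
      IsLatticeOptimal D → ∀ p : ℕ, p.Prime → p = 13 → p ^ 2 ∣ W.conductorNorm ℤ →
      ¬ (∃ (W' : WeierstrassCurve ℚ) (q : ℕ), W'.IsElliptic ∧ W'.IsGloballyMinimal ∧ q.Prime ∧
          q ≠ 2 ∧ q ^ 2 ∣ W.conductorNorm ℤ ∧
          IsIsogenous W (W'.quadraticTwist (((-1 : ℤ) ^ (q / 2) * q : ℤ) : ℚ)) ∧
          ¬ q ^ 2 ∣ W'.conductorNorm ℤ) →
      ¬ (∃ (W' : WeierstrassCurve ℚ) (d : ℤ), W'.IsElliptic ∧ W'.IsGloballyMinimal ∧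
          (d = -1 ∨ d = 2 ∨ d = -2) ∧ 2 ^ 2 ∣ W.conductorNorm ℤ ∧
          IsIsogenous W (W'.quadraticTwist (d : ℚ)) ∧ ¬ 2 ^ 2 ∣ W'.conductorNorm ℤ) →
      ¬ W.HasIrreducibleModPGaloisRep p →
      padicValInt p W.minimalDiscriminantInt ≤ 4 →
      (∃ (L : Type) (_ : Field L) (_ : NumberField L) (_ : IsCyclotomicExtension {p} ℚ L)
          (F : IntermediateField ℚ L),
          ∀ w : HeightOneSpectrum (𝓞 F), (p : 𝓞 F) ∈ w.asIdeal →
            (W.baseChange F).HasGoodReductionAt w ∧ (W.baseChange F).HasUnitRootAt w) →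
      p ∣ D.modularDegree →
      500000 < W.conductorNorm ℤ →
      ¬ (p : ℤ) ∣ D.maninConstant :=
  coreRED13sharp_of_edixhovenKodairaFact_of_degreeUp13Red stub_printedInputs.2.2.2.1 stub_degreeUp13Red

/-- COMPOSITION (sorry-free): the five v8 stubs prove crux C5 `ManinPrimeToAdditiveFiveLe` BY NAME — the width
seat's ledger `maninPrimeToAdditiveFiveLe_of_kato57_print_of_kp57_of_reducibleCores` (p611587) fed with
`coreRED57_of_cns_cremona_of_coreRED57sharp` (p612504) over the θ split (`red57sharp_of_split`, via p617914),
`coreRED11_of_mazurJ_of_coreRED13` (p612408),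
`coreRED13_of_cremona_of_coreRED13sharp` (p614544) and RED(13♯) from the degree law (`red13sharp_of_degreeUp13Red`,
via p618203). -/
theorem ManinPrimeToAdditiveFiveLe_of :
    Summit.BirchSwinnertonDyer.BirchSwinnertonDyer.Theses.ManinLocalTwoThree.ManinPrimeToAdditiveFiveLe :=
  maninPrimeToAdditiveFiveLe_of_kato57_print_of_kp57_of_reducibleCores
    stub_printedInputs.1 stub_printedInputs.2.1 stub_printedInputs.2.2.1 stub_printedInputs.2.2.2.1
    stub_printedInputs.2.2.2.2.1 stub_kp57
    (coreRED57_of_cns_cremona_of_coreRED57sharp stub_printedInputs.2.1 stub_printedInputs.2.2.1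
      red57sharp_of_split)
    (coreRED11_of_mazurJ_of_coreRED13 stub_printedInputs.2.2.2.2.2.1
      (coreRED13_of_cremona_of_coreRED13sharp stub_printedInputs.2.2.1 red13sharp_of_degreeUp13Red))


/-- COMPOSITION TWIN, hypothesis-taking (critic V#36 H1): the SEVEN stub STATEMENTS of this line imply crux C5 BY NAME with NO
stub (hence no `sorryAx`) inside the proof term — `#print axioms` of this theorem is stub-free; it is the certificate that the glue
of the line is complete. Same chain as `ManinPrimeToAdditiveFiveLe_of` (LEAD v8), with the cells glued by
`red57unstarredOffIIAtFive_of_hyps`. BSD is not proved by this; C5 is not proved by this (the hypotheses are open). -/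
theorem ManinPrimeToAdditiveFiveLe_of_hyps
    (hPI : type_of% stub_printedInputs) (hKP : type_of% stub_kp57) (hSS : type_of% stub_ss57)
    (hORD : type_of% stub_ord7) (hC : type_of% stub_corner57) (hU : type_of% stub_optimalUnstarredNonGord57)
    (hDeg : type_of% stub_degreeUp13Red) :
    Summit.BirchSwinnertonDyer.BirchSwinnertonDyer.Theses.ManinLocalTwoThree.ManinPrimeToAdditiveFiveLe :=
  maninPrimeToAdditiveFiveLe_of_kato57_print_of_kp57_of_reducibleCores
    hPI.1 hPI.2.1 hPI.2.2.1 hPI.2.2.2.1 hPI.2.2.2.2.1 hKP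
    (coreRED57_of_cns_cremona_of_coreRED57sharp hPI.2.1 hPI.2.2.1
      (coreRED57sharp_of_cns_of_unstarred_of_bistarred hPI.2.1
        (coreRED57unstarred_of_cns_of_offTypeIIAtFive_of_typeIIAtFiveCorner hPI.2.1
          (red57unstarredOffIIAtFive_of_hyps hSS hORD hC)
          (cornerTypeIIAtFive_of_optimalUnstarredNonGord hU))
        (red57bistarred_of_dokchitser_of_optimalUnstarredNonGord hPI.2.2.2.2.2.2
          (fun hnf W _ _ _ D hD p hp h57 hpN hodd hdy hred hN _hdeg hI hG ↦
            hU hnf W D hD p hp h57 hpN hodd hdy hred hN hI hG))))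
    (coreRED11_of_mazurJ_of_coreRED13 hPI.2.2.2.2.2.1
      (coreRED13_of_cremona_of_coreRED13sharp hPI.2.2.1
        (coreRED13sharp_of_edixhovenKodairaFact_of_degreeUp13Red hPI.2.2.2.1 hDeg)))

#print axioms ManinPrimeToAdditiveFiveLe_of_hyps

end Summit.BirchSwinnertonDyer.BirchSwinnertonDyer.Cruxes.ManinPrimeToAdditiveFiveLe.RaynaudCells

end
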